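import Mathlib
import Summits.NavierStokesRegularity.NavierStokesRegularity.Theorems.TypeIQuarterGateScarEnvelopeTypeIZoomDictionaryDefs
import Summits.NavierStokesRegularity.NavierStokesRegularity.Theorems.TypeIQuarterGateScarEnvelopeTypeIZoomDictionaryAbstract
import Summits.NavierStokesRegularity.NavierStokesRegularity.Theorems.TypeIQuarterGateScarEnvelopeTypeIZoomDictionaryVertex
import Summits.NavierStokesRegularity.NavierStokesRegularity.Theorems.TypeIQuarterGateScarEnvelopeTypeIZoomDictionarySmallSatellites
import Summits.NavierStokesRegularity.NavierStokesRegularity.Theorems.TypeIQuarterGateScarEnvelopeTypeIZoomDictionaryLargeSatellites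

/-!
# Part E: viscosity normalisation — the dictionary for `CruxHypotheses ν T u p`, any `ν > 0`

Part E of the plate: `timeRescale` covariance of cubes, budgets, singular points and tangent flows; `octaveBudget_iff_noSatellite_of_cruxHypotheses_visc` and the small-satellite form.

PROVENANCE: declaration texts VERBATIM from the HOME plates of the instrument seat nsreg-p3 (g24/g25, cell
`pub/ns-regularity-ideate`): `round-31/Tangent31prep.lean` v5 (sha16 `e5b8668e3a090216`; = ROUND-30 plate v10 + Part K) and,
for Part L, `round-32/Tangent32prep.lean` v6 (sha16 `6123f27718636121`);
the author cannot write under `Theorems/` (`perm.theorems-prover-only`); landed by the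
LEAD-lineage prover ns-sz-p1 g5 on director-ns DIRECTOR-NS #218 (2), split into ≤ 400-line modules (the
plate's `def`s gathered in `TypeIQuarterGateScarEnvelopeTypeIZoomDictionaryDefs`), namespace
`Summit.NavierStokesRegularity.NavierStokesRegularity.Cruxes.ScarEnvelopeTypeI.ZoomDictionary` (the plate's `NsregP3.R30P`), `E3` spelled out, one-line docstrings
added where the plate had none.  `--supports stmt-NavierStokesRegularity-23843 --as helper`.

HONEST FRAMING: dictionary / census TOOLING for the crux `TypeIQuarterGate.ScarEnvelopeTypeI` (item 23843):
equivalences and normal forms, kernel-checked; NO open statement is proved — 23843, its parent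
`QuarterLawTypeI` (23726), the route and Navier–Stokes regularity are OPEN; hard core evaded: none.
-/

-- the summit-side namespace repeats a component by design (single-conjunct summit, D-0017)
set_option linter.dupNamespace false

open MeasureTheory Set Metric Filter Topology
open scoped ENNReal

namespace Summit.NavierStokesRegularity.NavierStokesRegularity.Cruxes.ScarEnvelopeTypeI.ZoomDictionary

variable {u : ℝ → (EuclideanSpace ℝ (Fin 3)) → (EuclideanSpace ℝ (Fin 3))} {a : (EuclideanSpace ℝ (Fin 3))} {ν T : ℝ}

section ViscosityNormalisation

open Literature.Analysis.FluidPDE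

variable {u : ℝ → (EuclideanSpace ℝ (Fin 3)) → (EuclideanSpace ℝ (Fin 3))} {p : ℝ → (EuclideanSpace ℝ (Fin 3)) → ℝ} {a : (EuclideanSpace ℝ (Fin 3))} {ν T : ℝ}

/-- The viscosity/time rescaling by `c` is undone by the rescaling by `c⁻¹`. [folklore] -/
theorem timeRescale_inv_timeRescale {c : ℝ} (hc : 0 < c) (w : ℝ → (EuclideanSpace ℝ (Fin 3)) → (EuclideanSpace ℝ (Fin 3))) :
    timeRescale c⁻¹ c⁻¹ (timeRescale c c w) = w := by
  funext s x
  simp only [timeRescale_apply, smul_smul, inv_mul_cancel₀ hc.ne', one_smul, ← mul_assoc,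
    mul_inv_cancel₀ hc.ne', one_mul]

/-- The annular cube under the time rescaling by `c`: a factor `c³` and time `c s`. [folklore] -/
theorem octaveCube_timeRescale {c : ℝ} (hc : 0 < c) (u : ℝ → (EuclideanSpace ℝ (Fin 3)) → (EuclideanSpace ℝ (Fin 3))) (a : (EuclideanSpace ℝ (Fin 3))) (ℓ s : ℝ) :
    octaveCube (timeRescale c c u) a ℓ s =
      ENNReal.ofReal c ^ (3 : ℝ) * octaveCube u a ℓ (c * s) := by
  unfold octaveCube
  rw [← lintegral_const_mul' _ _
    (ENNReal.rpow_ne_top_of_nonneg (by norm_num) ENNReal.ofReal_ne_top)]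
  refine lintegral_congr fun y => ?_
  rw [timeRescale_apply, enorm_smul, ENNReal.mul_rpow_of_nonneg _ _ (by norm_num),
    Real.enorm_eq_ofReal hc.le]

/-- The slice budget transports under `v = c u(c ·)`: viscosity `c ν`, final time `T / c`. -/
theorem budgetAt_timeRescale {c : ℝ} (hc : 0 < c) (h : BudgetAt ν T u a) :
    BudgetAt (c * ν) (T / c) (timeRescale c c u) a := by
  obtain ⟨q, δ, r₀, hδ, hr₀, hB⟩ := h
  refine ⟨c ^ 3 * q, δ / c, r₀, div_pos hδ hc, hr₀, fun s hs ℓ hℓ1 hℓ2 => ?_⟩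
  have ht : c * s ∈ Ioo (T - δ) T := by
    constructor
    · have h1 : T / c - δ / c < s := hs.1
      have h2 := mul_lt_mul_of_pos_left h1 hc
      rw [mul_sub, mul_div_cancel₀ _ hc.ne', mul_div_cancel₀ _ hc.ne'] at h2
      exact h2
    · have h1 : s < T / c := hs.2
      have h2 := mul_lt_mul_of_pos_left h1 hc
      rw [mul_div_cancel₀ _ hc.ne'] at h2
      exact h2
  have hℓ1' : Real.sqrt (ν * (T - c * s)) ≤ ℓ := by
    have e : c * ν * (T / c - s) = ν * (T - c * s) := by
      field_simp
    rw [← e]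
    exact hℓ1
  have hb := hB (c * s) ht ℓ hℓ1' hℓ2
  rw [octaveCube_timeRescale hc]
  calc ENNReal.ofReal c ^ (3 : ℝ) * octaveCube u a ℓ (c * s)
      ≤ ENNReal.ofReal c ^ (3 : ℝ) * ENNReal.ofReal q := mul_le_mul' le_rfl hb
    _ = ENNReal.ofReal (c ^ 3 * q) := by
        rw [ENNReal.rpow_ofNat, ← ENNReal.ofReal_pow hc.le, ← ENNReal.ofReal_mul (pow_nonneg hc.le 3)]

/-- The budget is invariant under the viscosity normalisation `(ν, T, u) ↦ (cν, T/c, timeRescale c c u)`. [folklore] -/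
theorem budgetAt_timeRescale_iff {c : ℝ} (hc : 0 < c) :
    BudgetAt (c * ν) (T / c) (timeRescale c c u) a ↔ BudgetAt ν T u a := by
  refine ⟨fun h => ?_, budgetAt_timeRescale hc⟩
  have h' := budgetAt_timeRescale (inv_pos.2 hc) h
  rwa [timeRescale_inv_timeRescale hc, ← mul_assoc, inv_mul_cancel₀ hc.ne', one_mul, div_div,
    mul_inv_cancel₀ hc.ne', div_one] at h'

/-- Singular (unbounded) final-time points transport under `v = c u(c ·)`. -/
theorem singularPt_timeRescale {c : ℝ} (hc : 0 < c)
    (h : Summit.NavierStokesRegularity.NavierStokesRegularity.Cruxes.ScarEnvelopeTypeI.SliceBudget.SingularPt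
      T u a) :
    Summit.NavierStokesRegularity.NavierStokesRegularity.Cruxes.ScarEnvelopeTypeI.SliceBudget.SingularPt
      (T / c) (timeRescale c c u) a := by
  intro r hr hrT A
  set m : ℝ := min 1 (Real.sqrt c) with hm
  have hm0 : 0 < m := lt_min one_pos (Real.sqrt_pos.2 hc)
  have hm1 : m ≤ 1 := min_le_left _ _
  have hmc : m ^ 2 ≤ c := by
    have h1 : m ≤ Real.sqrt c := min_le_right _ _
    calc m ^ 2 ≤ Real.sqrt c ^ 2 := pow_le_pow_left₀ hm0.le h1 2
      _ = c := Real.sq_sqrt hc.le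
  have hr' : 0 < r * m := mul_pos hr hm0
  have hr'r : r * m ≤ r := mul_le_of_le_one_right hr.le hm1
  have hr'c : (r * m) ^ 2 ≤ c * r ^ 2 := by
    rw [mul_pow, mul_comm]
    exact mul_le_mul_of_nonneg_right hmc (sq_nonneg r)
  have hcT : c * r ^ 2 ≤ T := by
    have := hrT
    rw [le_div_iff₀ hc] at this
    linarith [mul_comm (r ^ 2) c]
  obtain ⟨t, ht, y, hy, hA⟩ := h (r * m) hr' (hr'c.trans hcT) (A / c)
  refine ⟨t / c, ⟨?_, ?_⟩, y, ball_subset_ball hr'r hy, ?_⟩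
  · rw [lt_div_iff₀ hc, sub_mul, div_mul_cancel₀ T hc.ne']
    have h1 : T - (r * m) ^ 2 < t := ht.1
    nlinarith
  · exact div_lt_div_of_pos_right ht.2 hc
  · have e : c * (t / c) = t := by field_simp
    rw [timeRescale_apply, e, norm_smul, Real.norm_eq_abs, abs_of_pos hc]
    rw [div_lt_iff₀ hc] at hA
    linarith [mul_comm (‖u t y‖) c]

/-- Singular points are invariant under the viscosity normalisation. [folklore] -/
theorem singularPt_timeRescale_iff {c : ℝ} (hc : 0 < c) :
    Summit.NavierStokesRegularity.NavierStokesRegularity.Cruxes.ScarEnvelopeTypeI.SliceBudget.SingularPt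
        (T / c) (timeRescale c c u) a ↔
      Summit.NavierStokesRegularity.NavierStokesRegularity.Cruxes.ScarEnvelopeTypeI.SliceBudget.SingularPt
        T u a := by
  refine ⟨fun h => ?_, singularPt_timeRescale hc⟩
  have h' := singularPt_timeRescale (inv_pos.2 hc) h
  rwa [timeRescale_inv_timeRescale hc, div_div, mul_inv_cancel₀ hc.ne', div_one] at h'

/-- **The crux-side `OctaveBudget` is invariant under the viscosity normalisation.** -/
theorem octaveBudget_timeRescale_iff {c : ℝ} (hc : 0 < c) :
    Summit.NavierStokesRegularity.NavierStokesRegularity.Cruxes.ScarEnvelopeTypeI.SliceBudget.OctaveBudget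
        (c * ν) (T / c) (timeRescale c c u) ↔
      Summit.NavierStokesRegularity.NavierStokesRegularity.Cruxes.ScarEnvelopeTypeI.SliceBudget.OctaveBudget
        ν T u := by
  rw [octaveBudget_iff_budgetAt, octaveBudget_iff_budgetAt]
  refine forall_congr' fun a => ?_
  rw [singularPt_timeRescale_iff hc, budgetAt_timeRescale_iff hc]

/-- The `L∞` Type-I rate is preserved by the viscosity normalisation (proof = the tree's
`isTypeIBlowup_timeRescale` in `…SelfMixingDichotomyCoherentScaleExclusionNoTypeII`, copied to keep
this plate's imports inside `Literature`). -/
theorem isTypeIBlowup_timeRescale_unit (hν : 0 < ν) (h : IsTypeIBlowup u T) :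
    IsTypeIBlowup (timeRescale ν⁻¹ ν⁻¹ u) (ν * T) := by
  obtain ⟨C, hC⟩ := h
  have hν0 : ν ≠ 0 := hν.ne'
  have hνi : 0 < ν⁻¹ := inv_pos.2 hν
  have hmaps : MapsTo (fun s : ℝ => ν⁻¹ * s) (Iio (ν * T)) (Iio T) := by
    intro s hs
    calc ν⁻¹ * s < ν⁻¹ * (ν * T) := mul_lt_mul_of_pos_left hs hνi
      _ = T := by rw [← mul_assoc, inv_mul_cancel₀ hν0, one_mul]
  have htend : Tendsto (fun s : ℝ => ν⁻¹ * s) (𝓝[<] (ν * T)) (𝓝[<] T) := by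
    have hcont : ContinuousWithinAt (fun s : ℝ => ν⁻¹ * s) (Iio (ν * T)) (ν * T) :=
      (continuous_const.mul continuous_id).continuousWithinAt
    have := hcont.tendsto_nhdsWithin hmaps
    rwa [← mul_assoc, inv_mul_cancel₀ hν0, one_mul] at this
  refine ⟨Real.sqrt ν⁻¹ * max C 0, ?_⟩
  filter_upwards [htend.eventually hC, self_mem_nhdsWithin] with s hs hsT x
  have hsT' : 0 < ν * T - s := sub_pos.2 hsT
  have hTs : T - ν⁻¹ * s = ν⁻¹ * (ν * T - s) := by field_simp
  have hsq : Real.sqrt (T - ν⁻¹ * s) = Real.sqrt ν⁻¹ * Real.sqrt (ν * T - s) := by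
    rw [hTs, Real.sqrt_mul hνi.le]
  have h1 : ‖u (ν⁻¹ * s) x‖ ≤ max C 0 / Real.sqrt (T - ν⁻¹ * s) :=
    (hs x).trans (div_le_div_of_nonneg_right (le_max_left _ _) (Real.sqrt_nonneg _))
  have hsi : 0 < Real.sqrt ν⁻¹ := Real.sqrt_pos.2 hνi
  have hsνT : 0 < Real.sqrt (ν * T - s) := Real.sqrt_pos.2 hsT'
  rw [timeRescale_apply, norm_smul, Real.norm_eq_abs, abs_of_pos hνi]
  calc ν⁻¹ * ‖u (ν⁻¹ * s) x‖ ≤ ν⁻¹ * (max C 0 / Real.sqrt (T - ν⁻¹ * s)) :=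
        mul_le_mul_of_nonneg_left h1 hνi.le
    _ = ν⁻¹ * (max C 0 / (Real.sqrt ν⁻¹ * Real.sqrt (ν * T - s))) := by rw [hsq]
    _ = Real.sqrt ν⁻¹ * max C 0 / Real.sqrt (ν * T - s) := by
        have haa : Real.sqrt ν⁻¹ * Real.sqrt ν⁻¹ = ν⁻¹ := Real.mul_self_sqrt hνi.le
        generalize Real.sqrt ν⁻¹ = a at haa hsi ⊢
        rw [← haa]
        field_simp

/-- **ROUND-30 (α) in the kernel, any `ν > 0`: the dictionary over the SD stub's `CruxHypotheses ν T u p`.**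
With `v = timeRescale ν⁻¹ ν⁻¹ u` (`v s x = ν⁻¹ u (s/ν) x`, unit viscosity, final time `νT`):
`OctaveBudget ν T u` holds iff at every singular final-time point `a` of `v`, for every pressure `q`
with `ZoomsInBall v q a (νT) ∧ ZoomsBddU v q a (νT)` (one exists), no tangent flow of `(v, q)` at
`(a, νT)` has a final-time satellite on the closed unit annulus.  No print theorem is a hypothesis. -/
theorem octaveBudget_iff_noSatellite_of_cruxHypotheses_visc
    (h : Summit.NavierStokesRegularity.NavierStokesRegularity.Cruxes.ScarEnvelopeTypeI.ScarZoom.CruxHypotheses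
      ν T u p) :
    Summit.NavierStokesRegularity.NavierStokesRegularity.Cruxes.ScarEnvelopeTypeI.SliceBudget.OctaveBudget
        ν T u ↔
      ∀ a, Summit.NavierStokesRegularity.NavierStokesRegularity.Cruxes.ScarEnvelopeTypeI.SliceBudget.SingularPt
          (ν * T) (timeRescale ν⁻¹ ν⁻¹ u) a →
        ∀ q : ℝ → (EuclideanSpace ℝ (Fin 3)) → ℝ, ZoomsInBall (timeRescale ν⁻¹ ν⁻¹ u) q a (ν * T) →
          ZoomsBddU (timeRescale ν⁻¹ ν⁻¹ u) q a (ν * T) →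
            ∀ L ū, TangentU (timeRescale ν⁻¹ ν⁻¹ u) q a (ν * T) L ū → ∀ y ∈ unitAnn, RegU ū y := by
  obtain ⟨hν, hT, hmax, hLH, hdec, hTI, -⟩ := h
  have hν0 : ν ≠ 0 := hν.ne'
  have hνi : 0 < ν⁻¹ := inv_pos.2 hν
  have hcl : IsClassicalNSSolutionOn (Ico 0 (ν * T)) 1 0 (timeRescale ν⁻¹ ν⁻¹ u)
      (timeRescale ν⁻¹ (ν⁻¹ ^ 2) p) :=
    (hmax.toUnitViscosity hν).isClassicalNSSolutionOn
  have hv0 : timeRescale ν⁻¹ ν⁻¹ u 0 = ν⁻¹ • u 0 := by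
    funext x
    rw [timeRescale_apply, mul_zero]
    rfl
  have hLH' : IsLerayHopfOn (ν * T) 1 0 (timeRescale ν⁻¹ ν⁻¹ u 0) (timeRescale ν⁻¹ ν⁻¹ u) := by
    have := hLH.viscosityRescale hνi
    rw [div_inv_eq_mul, mul_comm T ν, inv_mul_cancel₀ hν0, timeRescale_zero_force] at this
    rwa [hv0]
  have hd' : HasRapidSpatialDecay (timeRescale ν⁻¹ ν⁻¹ u 0) := by
    rw [hv0]
    exact SereginSverak2002_pressureOneSidedBound.hasRapidSpatialDecay_const_smul
      (hmax.isClassicalNSSolutionOn.contDiff_velocity ⟨le_rfl, hT⟩) hdec ν⁻¹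
  have hI' : IsTypeIBlowup (timeRescale ν⁻¹ ν⁻¹ u) (ν * T) := isTypeIBlowup_timeRescale_unit hν hTI
  have key := octaveBudget_timeRescale_iff (ν := ν) (T := T) (u := u) hνi
  rw [inv_mul_cancel₀ hν0, div_inv_eq_mul, mul_comm T ν] at key
  rw [← key, octaveBudget_iff_budgetAt]
  refine forall_congr' fun a => imp_congr_right fun _ => ?_
  exact budgetAt_iff_noSatellite_of_typeI (mul_pos hν hT) hcl hLH' hd' hI'

/-- **SD, read at every small satellite, any viscosity `ν > 0`** (the HEADLINE of Part F): under
the crux hypotheses, the tree's `OctaveBudget ν T u` holds iff every tangent flow of the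
unit-viscosity rescaling at every singular point is essentially bounded near every final-time
point `(0, y')` with `0 < |y'| ≤ e / c₀`. -/
theorem octaveBudget_iff_noSmallSatellite_of_cruxHypotheses_visc
    (h : Summit.NavierStokesRegularity.NavierStokesRegularity.Cruxes.ScarEnvelopeTypeI.ScarZoom.CruxHypotheses
      ν T u p) :
    Summit.NavierStokesRegularity.NavierStokesRegularity.Cruxes.ScarEnvelopeTypeI.SliceBudget.OctaveBudget
        ν T u ↔
      ∀ a, Summit.NavierStokesRegularity.NavierStokesRegularity.Cruxes.ScarEnvelopeTypeI.SliceBudget.SingularPt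
          (ν * T) (timeRescale ν⁻¹ ν⁻¹ u) a →
        ∀ q : ℝ → (EuclideanSpace ℝ (Fin 3)) → ℝ, ZoomsInBall (timeRescale ν⁻¹ ν⁻¹ u) q a (ν * T) →
          ZoomsBddU (timeRescale ν⁻¹ ν⁻¹ u) q a (ν * T) →
            ∀ L ū, TangentU (timeRescale ν⁻¹ ν⁻¹ u) q a (ν * T) L ū →
              ∀ y' : (EuclideanSpace ℝ (Fin 3)), y' ≠ 0 → ‖y'‖ ≤ Real.exp 1 / c₀ → RegPt ū y' :=
  (octaveBudget_iff_noSatellite_of_cruxHypotheses_visc h).trans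
    (forall_congr' fun _ => forall_congr' fun _ => forall_congr' fun _ => forall_congr' fun _ =>
      forall_congr' fun _ => noSatellite_iff_small)

-- negative control (must FAIL if uncommented): Part F does not prove the stub
-- example (h : Summit.NavierStokesRegularity.NavierStokesRegularity.Cruxes.ScarEnvelopeTypeI.ScarZoom.CruxHypotheses
--     ν T u p) :
--     Summit.NavierStokesRegularity.NavierStokesRegularity.Cruxes.ScarEnvelopeTypeI.SliceBudget.OctaveBudget
--       ν T u := (octaveBudget_iff_noSmallSatellite_of_cruxHypotheses_visc h).2 fun _ _ _ _ _ _ _ _ _ _ _ => by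
--   simp

/-- The unit-viscosity normalisation of the crux hypotheses (the preamble of the headlines). -/
theorem cruxHypotheses_unit
    (h : Summit.NavierStokesRegularity.NavierStokesRegularity.Cruxes.ScarEnvelopeTypeI.ScarZoom.CruxHypotheses
      ν T u p) :
    0 < ν ∧ 0 < ν * T ∧
      IsClassicalNSSolutionOn (Ico 0 (ν * T)) 1 0 (timeRescale ν⁻¹ ν⁻¹ u)
        (timeRescale ν⁻¹ (ν⁻¹ ^ 2) p) ∧
      IsLerayHopfOn (ν * T) 1 0 (timeRescale ν⁻¹ ν⁻¹ u 0) (timeRescale ν⁻¹ ν⁻¹ u) ∧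
      HasRapidSpatialDecay (timeRescale ν⁻¹ ν⁻¹ u 0) ∧
      IsTypeIBlowup (timeRescale ν⁻¹ ν⁻¹ u) (ν * T) ∧
      (Summit.NavierStokesRegularity.NavierStokesRegularity.Cruxes.ScarEnvelopeTypeI.SliceBudget.OctaveBudget
          ν T u ↔
        Summit.NavierStokesRegularity.NavierStokesRegularity.Cruxes.ScarEnvelopeTypeI.SliceBudget.OctaveBudget
          1 (ν * T) (timeRescale ν⁻¹ ν⁻¹ u)) := by
  obtain ⟨hν, hT, hmax, hLH, hdec, hTI, -⟩ := h
  have hν0 : ν ≠ 0 := hν.ne'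
  have hνi : 0 < ν⁻¹ := inv_pos.2 hν
  have hcl : IsClassicalNSSolutionOn (Ico 0 (ν * T)) 1 0 (timeRescale ν⁻¹ ν⁻¹ u)
      (timeRescale ν⁻¹ (ν⁻¹ ^ 2) p) :=
    (hmax.toUnitViscosity hν).isClassicalNSSolutionOn
  have hv0 : timeRescale ν⁻¹ ν⁻¹ u 0 = ν⁻¹ • u 0 := by
    funext x
    rw [timeRescale_apply, mul_zero]
    rfl
  have hLH' : IsLerayHopfOn (ν * T) 1 0 (timeRescale ν⁻¹ ν⁻¹ u 0) (timeRescale ν⁻¹ ν⁻¹ u) := by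
    have := hLH.viscosityRescale hνi
    rw [div_inv_eq_mul, mul_comm T ν, inv_mul_cancel₀ hν0, timeRescale_zero_force] at this
    rwa [hv0]
  have hd' : HasRapidSpatialDecay (timeRescale ν⁻¹ ν⁻¹ u 0) := by
    rw [hv0]
    exact SereginSverak2002_pressureOneSidedBound.hasRapidSpatialDecay_const_smul
      (hmax.isClassicalNSSolutionOn.contDiff_velocity ⟨le_rfl, hT⟩) hdec ν⁻¹
  have hI' : IsTypeIBlowup (timeRescale ν⁻¹ ν⁻¹ u) (ν * T) := isTypeIBlowup_timeRescale_unit hν hTI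
  have key := octaveBudget_timeRescale_iff (ν := ν) (T := T) (u := u) hνi
  rw [inv_mul_cancel₀ hν0, div_inv_eq_mul, mul_comm T ν] at key
  exact ⟨hν, mul_pos hν hT, hcl, hLH', hd', hI', key.symm⟩

/-- **SD, read at EVERY satellite in the unit ball, any viscosity `ν > 0`** (the HEADLINE of
Part G): under the crux hypotheses, the tree's `OctaveBudget ν T u` holds iff every tangent flow of
the unit-viscosity rescaling at every singular point is essentially bounded near every final-time
point `(0, y')` with `0 < |y'| < 1` — i.e. NO tangent flow has a final-time satellite singularity
anywhere off the blow-up axis (inside its domain `Q_1(0)`). -/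
theorem octaveBudget_iff_noSatelliteInBall_of_cruxHypotheses_visc
    (h : Summit.NavierStokesRegularity.NavierStokesRegularity.Cruxes.ScarEnvelopeTypeI.ScarZoom.CruxHypotheses
      ν T u p) :
    Summit.NavierStokesRegularity.NavierStokesRegularity.Cruxes.ScarEnvelopeTypeI.SliceBudget.OctaveBudget
        ν T u ↔
      ∀ a, Summit.NavierStokesRegularity.NavierStokesRegularity.Cruxes.ScarEnvelopeTypeI.SliceBudget.SingularPt
          (ν * T) (timeRescale ν⁻¹ ν⁻¹ u) a →
        ∀ q : ℝ → (EuclideanSpace ℝ (Fin 3)) → ℝ, ZoomsInBall (timeRescale ν⁻¹ ν⁻¹ u) q a (ν * T) →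
          ZoomsBddU (timeRescale ν⁻¹ ν⁻¹ u) q a (ν * T) →
            ∀ L ū, TangentU (timeRescale ν⁻¹ ν⁻¹ u) q a (ν * T) L ū →
              ∀ y' : (EuclideanSpace ℝ (Fin 3)), y' ≠ 0 → ‖y'‖ < 1 → RegPt ū y' := by
  obtain ⟨hν, hT', hcl, hLH', hd', hI', key⟩ := cruxHypotheses_unit h
  rw [key, octaveBudget_iff_budgetAt]
  refine forall_congr' fun a => imp_congr_right fun _ => ?_
  exact budgetAt_iff_noSatelliteInBall_of_typeI hT' hcl hLH' hd' hI'

-- negative control (must FAIL if uncommented): Part G does not prove the stub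
-- example (h : Summit.NavierStokesRegularity.NavierStokesRegularity.Cruxes.ScarEnvelopeTypeI.ScarZoom.CruxHypotheses
--     ν T u p) :
--     Summit.NavierStokesRegularity.NavierStokesRegularity.Cruxes.ScarEnvelopeTypeI.SliceBudget.OctaveBudget
--       ν T u := (octaveBudget_iff_noSatelliteInBall_of_cruxHypotheses_visc h).2
--   fun _ _ _ _ _ _ _ _ _ _ _ => ⟨1, one_pos, 0, by simp⟩

end ViscosityNormalisation

end Summit.NavierStokesRegularity.NavierStokesRegularity.Cruxes.ScarEnvelopeTypeI.ZoomDictionary
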